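import Summits.Ventures.CertifiedManyBodySolver.Observables.MeanFieldClassExclusionObjectEYbco
import Literature.MathematicalPhysics.QuantumLattice.HubbardFermiSeaFourCornerRowsYbco
import Literature.MathematicalPhysics.QuantumLattice.HubbardTTPrimePolarizedSeaCapTable
import Literature.MathematicalPhysics.QuantumLattice.HubbardFillingBoxEnergyBounds
import HarnessLib

/-!
# Ventures/CertifiedManyBodySolver — Observables/MeanFieldClassExclusionObjectEYbco106.lean

HONEST FRAMING: first certified bounds; not a superconductivity verdict; every number certified or labelled float.
A competing-order EXCLUSION removes a named class of candidate ground states; it never says which order is present;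
no phase sentence follows.

Cell `hubbard-tc` (MO-S3, D-0096), seat `hubbard-tc-mod-3` (G3: competing orders as exclusion inputs from certified energy ORDERINGS),
`prover-hubbard-tc-mod-3-g6-0`. File 2/2 of the YBa₂Cu₃O₆.₉₂ words (file 1 = `MeanFieldClassExclusionObjectEYbco.lean`, the CuO₂-plane
LIT-PREVIEW face `t' ∈ [−0.33, −0.22]`, conditional on #498 ∧ #445 ∧ #473). Here: the S1 **BOX OF RECORD #106** (VSET M18, `BOXES/YBa2Cu3O7.md`
§OF-RECORD v1, 2026-08-27T09:07Z, run-2 PBE + MLWF chain WAN:j272936), **OBJECT E** (`t–t'` effective set @n 0.84, `t″ ≡ 0`): P = 0 column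
`t'/t_eff ∈ [−0.63, −0.44]`, `U/t_eff ∈ [4.7, 11.4]`; P = 2 GPa column (transported) `t'/t_eff ∈ [−0.65, −0.42]`, `U/t_eff ∈ [4.4, 12.0]`;
`n(plane) ∈ [0.81, 0.92]` (T3 letter; the P5(b)-only reading `[0.795, 0.88]` is served by the annex `n ∈ [0.79, 0.81]`).

**What is new (method).** Every word in this file is HYPOTHESIS-FREE — no mbsolver claim node enters. On the deep hole-side `t'` of this box the
fully POLARISED one-species Fermi sea (a `U`-independent Slater determinant; kernel-certified cap planes `e₀(1, s, U, n_j) ≤ A_j + s·B_j` from the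
tree's `TTPrimeFree.polarizedPlaneCheck` certificates of `HubbardTTPrimePolarizedSeaCapTable` — the device hubbard-box-p2 uses for sandwich words)
lies `0.3–0.4·t` BELOW the transported CERTIFIED anchors the earlier G3 words used as caps (`objE_conc78_cap8` at `t' = −0.65`: `−0.45`; polarised
sea: `−0.81` at `n = 0.81`), so the docc tail closes at LOWER `U` and without #445/#473/#472: a non-magnetic Hartree–Fock / singlet-BCS state has
energy `≥ e_free(t', n) + U(n/2)²` (Wick, Bach–Lieb–Solovej), the ground state has energy `≤ e_pol(t', n)` at every `U`, and concavity in `U`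
turns the gap into `docc_GS ≤ (e_pol − e_free)/U < (n/2)²` for `U > (e_pol − e_free)/(n/2)²` (a certified Stoner-type threshold, `≈ 4.4–5.8` on this
face). The same reading applies to every deep-`t'` object-E box of the registry (Hg1201, Tl-2201, CCOC, nickelates) — successors: see EXCLUSION-TABLE §E.

Every word: for `t' ∈ [−13/20, −21/50]` (⊇ both pressure columns), EVERY `U ≥ U₁` and the stated filling band, every torus limit `ω` of unit
`(rectN n L, S^z = 0)`-sector ground states of `hubbardTorusTT' L 1 t' U` has `Re ω(n_{0↑} n_{0↓}) < (n/2)²` — no non-magnetic quasi-free /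
Hartree–Fock / singlet-BCS ground state (the identification is the docstring's reading; the THEOREM is the strict docc inequality):

* `ybco106E_docc_lt` — WHOLE face × `n ∈ [81/100, 23/25]`, EVERY `U ≥ 6` (P = 0 box covered on `[6, 11.4]`, P = 2 on `[6, 12.0]`);
  `ybco106E_P0_docc_lt` = the P = 0 letter `t' ∈ [−63/100, −11/25]`;
* `ybco106E_lowBand_docc_lt` — `n ∈ [81/100, 7/8]`, EVERY `U ≥ 11/2`; `ybco106E_highBand_docc_lt` — `n ∈ [7/8, 23/25]`, `U ≥ 6`;
* `ybco106E_lowN_docc_lt` — annex `n ∈ [79/100, 81/100]`, EVERY `U ≥ 24/5`; `ybco106E_wideLowBand_docc_lt` — `n ∈ [79/100, 7/8]`, `U ≥ 11/2`.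

Proof (no new mathematics): CAP = §1's four polarised-sea planes (density rows `0.79, 0.81, 7/8, 0.92`, valid on the whole `t'`-face and at every
`U ≥ 0`) read between rows by the density chord (`energyDensityTT'_le_density_chord_of_mem_Icc`, convexity in `n`); FLOOR = kernel Fermi-sea rows
(four-corner columns `−13/20`, `−113/200` of `HubbardFermiSeaFourCornerRowsYbco`; cell-exact tangent columns `−1/2`, `−2/5`) read between columns
by the `t'`-chord (`objE_floor_chord_between`, concavity in `t'`); TAIL = `doccN_lt_of_capUc_threshold` with `U_c := U` (the cap holds at `U`
itself; `(n/2)²` above its tangent at the band's lower filling). Cap chord, floor chord and tangent are bilinear in `(n, t')`; each of the three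
`t'`-pieces is ONE `nlinarith` leaf with the four McCormick products of its rectangle (corner-exact). Exact leaf margins (designer
`hubbard-tc-mod-3/g6-replay/ybco106/design106u.py`, exact rationals on the tree constants): low band `+0.034/+0.034/+0.020`, high band
`+0.016/+0.024/+0.030`, annex `+0.051/+0.039/+0.011`; binding corners at the TOP filling of each band (the polarisation cost `e_pol − e_free`
grows with `n`). A conditional variant with the #445/#473/#472 caps (designer `design106b.py`, checked, NOT filed) reaches only `U ≥ 6.9 / 6.5 / 6.2`
on the three `t'`-pieces — dominated. No saturated-FM EXCLUSION is possible here by content: the polarised state is the cap.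
WHAT THIS IS NOT: a statement about the bilayer (`t⊥`), the chains, `t″` (object M), stripes/CDW, d-wave order or T_c; tight; a phase word;
a claim that the ground state IS polarised anywhere.

References: V. Bach, E. H. Lieb, J. P. Solovej, J. Stat. Phys. 76 (1994) 3, eq. (2c.36) [BachLiebSolovej1994]; T. Koma, H. Tasaki, J. Stat.
Phys. 76 (1994) 745, §1 [KomaTasaki1994]; E. H. Lieb, M. Loss, Duke Math. J. 71 (1993) 337, §8 Thm 8.2 [LiebLoss1993]; R. B. Israel, Convexity
in the Theory of Lattice Gases (1979), Thm I.3.4 [Israel1979]; D. Ruelle, Statistical Mechanics (1969) §3.3 [Ruelle1969]; A. Neumaier, Acta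
Numerica 13 (2004) 271, §11 [Neumaier2004CompleteSearch].
-/

noncomputable section

namespace Summit.Ventures.CertifiedManyBodySolver.Observables

open Literature.MathematicalPhysics.QuantumLattice
open Literature.MathematicalPhysics.QuantumLattice.ThermodynamicLimit
open Literature.MathematicalPhysics.QuantumLattice.TTPrimeFree
open Summit.Ventures.CertifiedManyBodySolver.Certificates
open Matrix HubbardWave0 Literature.Probability.LatticeModels Filter Topology Set
open scoped ComplexOrder BigOperators

/-! ### §0 Two division-free chord devices (numeral inverse supplied by the caller, so that the McCormick leaves stay `linarith`-readable) -/

/-- **Density chord of two caps on the CLOSED band, division-free**: caps `e(1, s, U, m₁) ≤ u₁`, `e(1, s, U, m₂) ≤ u₂` (`0 ≤ m₁ < m₂ < 2`, `U ≥ 0`),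
`m₁ ≤ n ≤ m₂` and `k·(m₂ − m₁) = 1` give `e(1, s, U, n) ≤ k·((m₂ − n)u₁ + (n − m₁)u₂)` (convexity in the density;
`energyDensityTT'_le_density_chord_of_mem_Icc`). [cite: Ruelle1969, §3.3] -/
theorem objE_capChord_mul {s U n m₁ m₂ u₁ u₂ k : ℝ} (hU : 0 ≤ U) (hm₁ : 0 ≤ m₁) (hm : m₁ < m₂) (hm₂ : m₂ < 2)
    (hu₁ : energyDensityTT' 1 s U m₁ ≤ u₁) (hu₂ : energyDensityTT' 1 s U m₂ ≤ u₂) (h1 : m₁ ≤ n) (h2 : n ≤ m₂)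
    (hk : k * (m₂ - m₁) = 1) :
    energyDensityTT' 1 s U n ≤ k * ((m₂ - n) * u₁ + (n - m₁) * u₂) := by
  have h := energyDensityTT'_le_density_chord_of_mem_Icc 1 s hU hm₁ hm hm₂ hu₁ hu₂ ⟨h1, h2⟩
  have hk' : k = (m₂ - m₁)⁻¹ := eq_inv_of_mul_eq_one_left hk
  rw [hk', ← div_eq_inv_mul]
  exact h

/-- **`t'`-chord of two column floors, division-free** (`objE_floor_chord_between` at `U = 0` with `k·(b − a) = 1`):
`k·((b − s)·Fa + (s − a)·Fb) ≤ e(1, s, 0, n)` for `a ≤ s ≤ b`. [cite: Israel1979, Thm. I.3.4] -/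
theorem objE_floorChord_mul {a b s n Fa Fb k : ℝ} (hn0 : 0 ≤ n) (hn2 : n < 2) (hab : a < b)
    (hFa : Fa ≤ energyDensityTT' 1 a 0 n) (hFb : Fb ≤ energyDensityTT' 1 b 0 n) (has : a ≤ s) (hsb : s ≤ b)
    (hk : k * (b - a) = 1) :
    k * ((b - s) * Fa + (s - a) * Fb) ≤ energyDensityTT' 1 s 0 n := by
  have h := objE_floor_chord_between (U := 0) le_rfl hn0 hn2 hab hFa hFb has hsb
  have hk' : k = (b - a)⁻¹ := eq_inv_of_mul_eq_one_left hk
  rw [hk', ← div_eq_inv_mul]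
  exact h

/-! ### §1 Kernel polarised-sea cap planes on the face `t' ∈ [−13/20, −21/50]` (four density rows) -/

/-- Kernel check of the polarised-sea cap PLANE at `n = 79/100` (`|S| = 1264` of `1600` grid cells, `M = 40`; the `336` excluded cells are the
per-row `j`-pockets around `(π, π)` listed inline; plane `A_S ≈ -0.5904198`, `B_S ≈ +0.3964711`; claimed `A = -2952083843/5000000000`, `B = 3964711/10000000`, margin `3·10⁻⁶`).
Generator `hubbard-tc-mod-3/g6-replay/ybco106/polcap106.py` (affine port of hubbard-box-p2's `polcap_emit.py`); the kernel re-derives everything. [cite: BachLiebSolovej1994, eq. (2c.36)] -/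
theorem ybco106_polCap_n0790_check :
    polarizedPlaneCheck 40 1 (-13/20) (-21/50)
      (selPocket [(0, 0), (0, 0), (0, 0), (0, 0), (0, 0), (0, 0), (0, 0), (0, 0), (0, 0), (0, 0), (16, 24), (14, 26), (12, 28), (12, 28), (11, 29), (11, 29), (10, 30), (10, 30), (10, 30), (10, 30), (10, 30), (10, 30), (10, 30), (10, 30), (11, 29), (11, 29), (12, 28), (12, 28), (14, 26), (16, 24), (0, 0), (0, 0), (0, 0), (0, 0), (0, 0), (0, 0), (0, 0), (0, 0), (0, 0), (0, 0)])
      1264 (-2952083843/5000000000) (3964711/10000000) = true := by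
  decide +kernel

/-- **Polarised-sea cap plane** `e₀(1, s, U, 79/100) ≤ -0.5904167686 + s·0.3964711` for every `U ≥ 0` and every `s ∈ [−13/20, −21/50]` — the fully
polarised one-species grid-cell sea (no double occupancy, hence uniform in `U`; Bach–Lieb–Solovej (2c.36)), `≈ 1·10⁻³` above the `M → ∞` polarised energy
on this interval. HYPOTHESIS-FREE. [cite: BachLiebSolovej1994, eq. (2c.36)] -/
theorem ybco106_polCap_n0790 {U : ℝ} (hU : 0 ≤ U) {s : ℝ} (h₁ : (-13 / 20 : ℝ) ≤ s) (h₂ : s ≤ -21 / 50) :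
    energyDensityTT' 1 s U (79 / 100) ≤ (-2952083843 / 5000000000 : ℝ) + s * (3964711 / 10000000 : ℝ) := by
  have h := energyDensityTT'_le_affine_of_polarizedPlaneCheck (n := 79 / 100) (s := s) (by norm_num)
    ybco106_polCap_n0790_check hU (by norm_num) (by push_cast; linarith) (by push_cast; linarith)
  push_cast at h
  linarith

/-- Kernel check of the polarised-sea cap PLANE at `n = 81/100` (`|S| = 1296` of `1600` grid cells, `M = 40`; the `304` excluded cells are the
per-row `j`-pockets around `(π, π)` listed inline; plane `A_S ≈ -0.5539412`, `B_S ≈ +0.3872063`; claimed `A = -5539382399/10000000000`, `B = 3872063/10000000`, margin `3·10⁻⁶`).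
Generator `hubbard-tc-mod-3/g6-replay/ybco106/polcap106.py` (affine port of hubbard-box-p2's `polcap_emit.py`); the kernel re-derives everything. [cite: BachLiebSolovej1994, eq. (2c.36)] -/
theorem ybco106_polCap_n0810_check :
    polarizedPlaneCheck 40 1 (-13/20) (-21/50)
      (selPocket [(0, 0), (0, 0), (0, 0), (0, 0), (0, 0), (0, 0), (0, 0), (0, 0), (0, 0), (0, 0), (18, 22), (15, 25), (14, 26), (13, 27), (12, 28), (11, 29), (11, 29), (11, 29), (10, 30), (10, 30), (10, 30), (10, 30), (11, 29), (11, 29), (11, 29), (12, 28), (12, 28), (13, 27), (15, 25), (18, 22), (0, 0), (0, 0), (0, 0), (0, 0), (0, 0), (0, 0), (0, 0), (0, 0), (0, 0), (0, 0)])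
      1296 (-5539382399/10000000000) (3872063/10000000) = true := by
  decide +kernel

/-- **Polarised-sea cap plane** `e₀(1, s, U, 81/100) ≤ -0.5539382399 + s·0.3872063` for every `U ≥ 0` and every `s ∈ [−13/20, −21/50]` — the fully
polarised one-species grid-cell sea (no double occupancy, hence uniform in `U`; Bach–Lieb–Solovej (2c.36)), `≈ 1·10⁻³` above the `M → ∞` polarised energy
on this interval. HYPOTHESIS-FREE. [cite: BachLiebSolovej1994, eq. (2c.36)] -/
theorem ybco106_polCap_n0810 {U : ℝ} (hU : 0 ≤ U) {s : ℝ} (h₁ : (-13 / 20 : ℝ) ≤ s) (h₂ : s ≤ -21 / 50) :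
    energyDensityTT' 1 s U (81 / 100) ≤ (-5539382399 / 10000000000 : ℝ) + s * (3872063 / 10000000 : ℝ) := by
  have h := energyDensityTT'_le_affine_of_polarizedPlaneCheck (n := 81 / 100) (s := s) (by norm_num)
    ybco106_polCap_n0810_check hU (by norm_num) (by push_cast; linarith) (by push_cast; linarith)
  push_cast at h
  linarith

/-- Kernel check of the polarised-sea cap PLANE at `n = 7/8` (`|S| = 1400` of `1600` grid cells, `M = 40`; the `200` excluded cells are the
per-row `j`-pockets around `(π, π)` listed inline; plane `A_S ≈ -0.4074541`, `B_S ≈ +0.3272967`; claimed `A = -4074510317/10000000000`, `B = 3272967/10000000`, margin `3·10⁻⁶`).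
Generator `hubbard-tc-mod-3/g6-replay/ybco106/polcap106.py` (affine port of hubbard-box-p2's `polcap_emit.py`); the kernel re-derives everything. [cite: BachLiebSolovej1994, eq. (2c.36)] -/
theorem ybco106_polCap_n0875_check :
    polarizedPlaneCheck 40 1 (-13/20) (-21/50)
      (selPocket [(0, 0), (0, 0), (0, 0), (0, 0), (0, 0), (0, 0), (0, 0), (0, 0), (0, 0), (0, 0), (0, 0), (0, 0), (18, 22), (15, 25), (14, 26), (13, 27), (13, 27), (13, 27), (12, 28), (12, 28), (12, 28), (12, 28), (13, 27), (13, 27), (13, 27), (14, 26), (15, 25), (18, 22), (0, 0), (0, 0), (0, 0), (0, 0), (0, 0), (0, 0), (0, 0), (0, 0), (0, 0), (0, 0), (0, 0), (0, 0)])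
      1400 (-4074510317/10000000000) (3272967/10000000) = true := by
  decide +kernel

/-- **Polarised-sea cap plane** `e₀(1, s, U, 7/8) ≤ -0.4074510317 + s·0.3272967` for every `U ≥ 0` and every `s ∈ [−13/20, −21/50]` — the fully
polarised one-species grid-cell sea (no double occupancy, hence uniform in `U`; Bach–Lieb–Solovej (2c.36)), `≈ 1·10⁻³` above the `M → ∞` polarised energy
on this interval. HYPOTHESIS-FREE. [cite: BachLiebSolovej1994, eq. (2c.36)] -/
theorem ybco106_polCap_n0875 {U : ℝ} (hU : 0 ≤ U) {s : ℝ} (h₁ : (-13 / 20 : ℝ) ≤ s) (h₂ : s ≤ -21 / 50) :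
    energyDensityTT' 1 s U (7 / 8) ≤ (-4074510317 / 10000000000 : ℝ) + s * (3272967 / 10000000 : ℝ) := by
  have h := energyDensityTT'_le_affine_of_polarizedPlaneCheck (n := 7 / 8) (s := s) (by norm_num)
    ybco106_polCap_n0875_check hU (by norm_num) (by push_cast; linarith) (by push_cast; linarith)
  push_cast at h
  linarith

/-- Kernel check of the polarised-sea cap PLANE at `n = 23/25` (`|S| = 1472` of `1600` grid cells, `M = 40`; the `128` excluded cells are the
per-row `j`-pockets around `(π, π)` listed inline; plane `A_S ≈ -0.2809472`, `B_S ≈ +0.2456705`; claimed `A = -2809441317/10000000000`, `B = 491341/2000000`, margin `3·10⁻⁶`).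
Generator `hubbard-tc-mod-3/g6-replay/ybco106/polcap106.py` (affine port of hubbard-box-p2's `polcap_emit.py`); the kernel re-derives everything. [cite: BachLiebSolovej1994, eq. (2c.36)] -/
theorem ybco106_polCap_n0920_check :
    polarizedPlaneCheck 40 1 (-13/20) (-21/50)
      (selPocket [(0, 0), (0, 0), (0, 0), (0, 0), (0, 0), (0, 0), (0, 0), (0, 0), (0, 0), (0, 0), (0, 0), (0, 0), (0, 0), (0, 0), (16, 23), (15, 25), (14, 26), (14, 26), (14, 26), (14, 26), (14, 26), (14, 26), (14, 26), (15, 25), (15, 25), (16, 23), (0, 0), (0, 0), (0, 0), (0, 0), (0, 0), (0, 0), (0, 0), (0, 0), (0, 0), (0, 0), (0, 0), (0, 0), (0, 0), (0, 0)])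
      1472 (-2809441317/10000000000) (491341/2000000) = true := by
  decide +kernel

/-- **Polarised-sea cap plane** `e₀(1, s, U, 23/25) ≤ -0.2809441317 + s·0.2456705` for every `U ≥ 0` and every `s ∈ [−13/20, −21/50]` — the fully
polarised one-species grid-cell sea (no double occupancy, hence uniform in `U`; Bach–Lieb–Solovej (2c.36)), `≈ 1·10⁻³` above the `M → ∞` polarised energy
on this interval. HYPOTHESIS-FREE. [cite: BachLiebSolovej1994, eq. (2c.36)] -/
theorem ybco106_polCap_n0920 {U : ℝ} (hU : 0 ≤ U) {s : ℝ} (h₁ : (-13 / 20 : ℝ) ≤ s) (h₂ : s ≤ -21 / 50) :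
    energyDensityTT' 1 s U (23 / 25) ≤ (-2809441317 / 10000000000 : ℝ) + s * (491341 / 2000000 : ℝ) := by
  have h := energyDensityTT'_le_affine_of_polarizedPlaneCheck (n := 23 / 25) (s := s) (by norm_num)
    ybco106_polCap_n0920_check hU (by norm_num) (by push_cast; linarith) (by push_cast; linarith)
  push_cast at h
  linarith

/-! ### §2 The band words (each: cap chord in `n`, floor chords in `t'` over three column pieces, one McCormick leaf per piece) -/

/-- **YBa₂Cu₃O₆.₉₂ #106 OBJECT E, filling band `n ∈ [81/100, 7/8]`, WHOLE `t'`-face `[−13/20, −21/50]` — MF/BCS class excluded at EVERY `U ≥ 11/2`, HYPOTHESIS-FREE.** Every GS torus limit has `Re ω(n_{0↑}n_{0↓}) < (n/2)²`. Cap = density chord of the polarised-sea planes at `n = 81/100`, `7/8` (§1); floor = `t'`-chord of the kernel Fermi-sea columns `−13/20 | −113/200 | −1/2 | −2/5` (touch `33/40`, `21/25`); exact margins `+0.034 / +0.034 / +0.020` (binding corner `(n, t') = (7/8, −21/50)`). [cite: KomaTasaki1994, §1] [cite: BachLiebSolovej1994, eq. (2c.36)] [cite: LiebLoss1993, §8,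 Theorem 8.2] -/
theorem ybco106E_lowBand_docc_lt {t' U n : ℝ} (ht1 : -13 / 20 ≤ t') (ht2 : t' ≤ -21 / 50) (hU : 11 / 2 ≤ U)
    (hn1 : 81 / 100 ≤ n) (hn2 : n ≤ 7 / 8) :
    ∀ (ω : InfVolFermionState 2) (Ls : ℕ → ℕ) (ψ : ∀ L, Fock (Orb (FermionTorus 2 L))),
      Tendsto Ls atTop atTop →
      (∀ j, IsGroundStateInSector (hubbardTorusTT' (Ls j) 1 t' U) (rectN n (Ls j)) 0 (ψ (Ls j))) →
      (∀ j, star (ψ (Ls j)) ⬝ᵥ ψ (Ls j) = 1) → ω.IsTorusLimitOf ψ Ls →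
      (ω.expect ({0} : Finset (Site 2))
        (nAt 0 (Finset.mem_singleton_self 0) 0 * nAt 0 (Finset.mem_singleton_self 0) 1)).re < (n / 2) ^ 2 := by
  have hn0 : (0 : ℝ) ≤ n := by linarith
  have hn2' : n < 2 := by linarith
  have hU0 : (0 : ℝ) ≤ U := by linarith
  have hsq : (-6561 / 40000 : ℝ) + 81 / 200 * n ≤ (n / 2) ^ 2 := by nlinarith [sq_nonneg (n - 81 / 100)]
  have hsqU : ((-6561 / 40000 : ℝ) + 81 / 200 * n) * (11 / 2) ≤ (n / 2) ^ 2 * (11 / 2) :=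
    mul_le_mul_of_nonneg_right hsq (by norm_num)
  -- CAP: chord in the density between the two polarised-sea planes (convexity of the density function)
  have ca := ybco106_polCap_n0810 hU0 ht1 ht2
  have cb := ybco106_polCap_n0875 hU0 ht1 ht2
  have hcap := objE_capChord_mul (k := 200 / 13) hU0 (by norm_num) (by norm_num) (by norm_num) ca cb hn1 hn2 (by norm_num)
  -- FLOOR: chord in t' between two kernel Fermi-sea columns (concavity in t'), three pieces
  rcases le_or_gt t' (-113 / 200) with hp | hp
  · -- piece `[-13/20, -113/200]`
    have ra := fermiSeaRow4_tPrime_neg_thirteen_div_twenty_at_thirtythree_div_forty (U := 0) le_rfl hn0 hn2'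
    have rb := fermiSeaRow4_tPrime_neg_hundredthirteen_div_twohundred_at_thirtythree_div_forty (U := 0) le_rfl hn0 hn2'
    have hfl := objE_floorChord_mul (s := t') (k := 200 / 17) hn0 hn2' (by norm_num : (-13 / 20 : ℝ) < -113 / 200) ra rb ht1 hp (by norm_num)
    exact doccN_lt_of_capUc_threshold (U₁ := 11 / 2) (Uc := U) (by norm_num) hU hU hn0 hn2' hcap hfl
      (by nlinarith only [mul_nonneg (sub_nonneg.2 hn1) (sub_nonneg.2 ht1), mul_nonneg (sub_nonneg.2 hn1) (sub_nonneg.2 hp), mul_nonneg (sub_nonneg.2 hn2) (sub_nonneg.2 ht1), mul_nonneg (sub_nonneg.2 hn2) (sub_nonneg.2 hp), hsqU])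
  · rcases le_or_gt t' (-1 / 2) with hq | hq
    · -- piece `(-113/200, -1/2]`
      have ra := fermiSeaRow4_tPrime_neg_hundredthirteen_div_twohundred_at_thirtythree_div_forty (U := 0) le_rfl hn0 hn2'
      have rb := fermiSeaTangentRow_tPrime_neg_one_div_two_at_twentyone_div_twentyfive (U := 0) le_rfl hn0 hn2'
      have hfl := objE_floorChord_mul (s := t') (k := 200 / 13) hn0 hn2' (by norm_num : (-113 / 200 : ℝ) < -1 / 2) ra rb hp.le hq (by norm_num)
      exact doccN_lt_of_capUc_threshold (U₁ := 11 / 2) (Uc := U) (by norm_num) hU hU hn0 hn2' hcap hfl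
        (by nlinarith only [mul_nonneg (sub_nonneg.2 hn1) (sub_nonneg.2 hp.le), mul_nonneg (sub_nonneg.2 hn1) (sub_nonneg.2 hq), mul_nonneg (sub_nonneg.2 hn2) (sub_nonneg.2 hp.le), mul_nonneg (sub_nonneg.2 hn2) (sub_nonneg.2 hq), hsqU])
    · -- piece `(-1/2, -21/50]` (columns `-1/2`, `-2/5`)
      have ra := fermiSeaTangentRow_tPrime_neg_one_div_two_at_twentyone_div_twentyfive (U := 0) le_rfl hn0 hn2'
      have rb := fermiSeaTangentRow_tPrime_neg_two_div_five_at_twentyone_div_twentyfive (U := 0) le_rfl hn0 hn2'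
      have hfl := objE_floorChord_mul (s := t') (k := 10) hn0 hn2' (by norm_num : (-1 / 2 : ℝ) < -2 / 5) ra rb hq.le (by linarith) (by norm_num)
      exact doccN_lt_of_capUc_threshold (U₁ := 11 / 2) (Uc := U) (by norm_num) hU hU hn0 hn2' hcap hfl
        (by nlinarith only [mul_nonneg (sub_nonneg.2 hn1) (sub_nonneg.2 hq.le), mul_nonneg (sub_nonneg.2 hn1) (sub_nonneg.2 ht2), mul_nonneg (sub_nonneg.2 hn2) (sub_nonneg.2 hq.le), mul_nonneg (sub_nonneg.2 hn2) (sub_nonneg.2 ht2), hsqU])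

/-- **#106 OBJECT E, filling band `n ∈ [7/8, 23/25]`, WHOLE `t'`-face — MF/BCS class excluded at EVERY `U ≥ 6`, HYPOTHESIS-FREE** (polarised-sea planes at `7/8`, `23/25`; Fermi-sea columns at touch `9/10`; exact margins `+0.016 / +0.024 / +0.030`, binding corner `(23/25, −13/20)`). [cite: KomaTasaki1994, §1] [cite: BachLiebSolovej1994, eq. (2c.36)] [cite: LiebLoss1993, §8, Theorem 8.2] -/
theorem ybco106E_highBand_docc_lt {t' U n : ℝ} (ht1 : -13 / 20 ≤ t') (ht2 : t' ≤ -21 / 50) (hU : 6 ≤ U)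
    (hn1 : 7 / 8 ≤ n) (hn2 : n ≤ 23 / 25) :
    ∀ (ω : InfVolFermionState 2) (Ls : ℕ → ℕ) (ψ : ∀ L, Fock (Orb (FermionTorus 2 L))),
      Tendsto Ls atTop atTop →
      (∀ j, IsGroundStateInSector (hubbardTorusTT' (Ls j) 1 t' U) (rectN n (Ls j)) 0 (ψ (Ls j))) →
      (∀ j, star (ψ (Ls j)) ⬝ᵥ ψ (Ls j) = 1) → ω.IsTorusLimitOf ψ Ls →
      (ω.expect ({0} : Finset (Site 2))
        (nAt 0 (Finset.mem_singleton_self 0) 0 * nAt 0 (Finset.mem_singleton_self 0) 1)).re < (n / 2) ^ 2 := by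
  have hn0 : (0 : ℝ) ≤ n := by linarith
  have hn2' : n < 2 := by linarith
  have hU0 : (0 : ℝ) ≤ U := by linarith
  have hsq : (-49 / 256 : ℝ) + 7 / 16 * n ≤ (n / 2) ^ 2 := by nlinarith [sq_nonneg (n - 7 / 8)]
  have hsqU : ((-49 / 256 : ℝ) + 7 / 16 * n) * (6) ≤ (n / 2) ^ 2 * (6) :=
    mul_le_mul_of_nonneg_right hsq (by norm_num)
  -- CAP: chord in the density between the two polarised-sea planes (convexity of the density function)
  have ca := ybco106_polCap_n0875 hU0 ht1 ht2
  have cb := ybco106_polCap_n0920 hU0 ht1 ht2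
  have hcap := objE_capChord_mul (k := 200 / 9) hU0 (by norm_num) (by norm_num) (by norm_num) ca cb hn1 hn2 (by norm_num)
  -- FLOOR: chord in t' between two kernel Fermi-sea columns (concavity in t'), three pieces
  rcases le_or_gt t' (-113 / 200) with hp | hp
  · -- piece `[-13/20, -113/200]`
    have ra := fermiSeaRow4_tPrime_neg_thirteen_div_twenty_at_nine_div_ten (U := 0) le_rfl hn0 hn2'
    have rb := fermiSeaRow4_tPrime_neg_hundredthirteen_div_twohundred_at_nine_div_ten (U := 0) le_rfl hn0 hn2'
    have hfl := objE_floorChord_mul (s := t') (k := 200 / 17) hn0 hn2' (by norm_num : (-13 / 20 : ℝ) < -113 / 200) ra rb ht1 hp (by norm_num)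
    exact doccN_lt_of_capUc_threshold (U₁ := 6) (Uc := U) (by norm_num) hU hU hn0 hn2' hcap hfl
      (by nlinarith only [mul_nonneg (sub_nonneg.2 hn1) (sub_nonneg.2 ht1), mul_nonneg (sub_nonneg.2 hn1) (sub_nonneg.2 hp), mul_nonneg (sub_nonneg.2 hn2) (sub_nonneg.2 ht1), mul_nonneg (sub_nonneg.2 hn2) (sub_nonneg.2 hp), hsqU])
  · rcases le_or_gt t' (-1 / 2) with hq | hq
    · -- piece `(-113/200, -1/2]`
      have ra := fermiSeaRow4_tPrime_neg_hundredthirteen_div_twohundred_at_nine_div_ten (U := 0) le_rfl hn0 hn2'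
      have rb := fermiSeaTangentRow_tPrime_neg_one_div_two_at_nine_div_ten (U := 0) le_rfl hn0 hn2'
      have hfl := objE_floorChord_mul (s := t') (k := 200 / 13) hn0 hn2' (by norm_num : (-113 / 200 : ℝ) < -1 / 2) ra rb hp.le hq (by norm_num)
      exact doccN_lt_of_capUc_threshold (U₁ := 6) (Uc := U) (by norm_num) hU hU hn0 hn2' hcap hfl
        (by nlinarith only [mul_nonneg (sub_nonneg.2 hn1) (sub_nonneg.2 hp.le), mul_nonneg (sub_nonneg.2 hn1) (sub_nonneg.2 hq), mul_nonneg (sub_nonneg.2 hn2) (sub_nonneg.2 hp.le), mul_nonneg (sub_nonneg.2 hn2) (sub_nonneg.2 hq), hsqU])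
    · -- piece `(-1/2, -21/50]` (columns `-1/2`, `-2/5`)
      have ra := fermiSeaTangentRow_tPrime_neg_one_div_two_at_nine_div_ten (U := 0) le_rfl hn0 hn2'
      have rb := fermiSeaTangentRow_tPrime_neg_two_div_five_at_nine_div_ten (U := 0) le_rfl hn0 hn2'
      have hfl := objE_floorChord_mul (s := t') (k := 10) hn0 hn2' (by norm_num : (-1 / 2 : ℝ) < -2 / 5) ra rb hq.le (by linarith) (by norm_num)
      exact doccN_lt_of_capUc_threshold (U₁ := 6) (Uc := U) (by norm_num) hU hU hn0 hn2' hcap hfl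
        (by nlinarith only [mul_nonneg (sub_nonneg.2 hn1) (sub_nonneg.2 hq.le), mul_nonneg (sub_nonneg.2 hn1) (sub_nonneg.2 ht2), mul_nonneg (sub_nonneg.2 hn2) (sub_nonneg.2 hq.le), mul_nonneg (sub_nonneg.2 hn2) (sub_nonneg.2 ht2), hsqU])

/-- **#106 OBJECT E, low-density annex `n ∈ [79/100, 81/100]` (serves the P5(b)-only reading `n(plane) ≥ 0.795`), WHOLE `t'`-face — MF/BCS class excluded at EVERY `U ≥ 24/5`, HYPOTHESIS-FREE** (polarised-sea planes at `79/100`, `81/100`; Fermi-sea columns at touch `4/5` / `3/4`; exact margins `+0.051 / +0.039 / +0.011`, binding corner `(81/100, −21/50)`). [cite: KomaTasaki1994, §1] [cite: BachLiebSolovej1994, eq. (2c.36)] [cite: LiebLoss1993, §8, Theorem 8.2] -/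
theorem ybco106E_lowN_docc_lt {t' U n : ℝ} (ht1 : -13 / 20 ≤ t') (ht2 : t' ≤ -21 / 50) (hU : 24 / 5 ≤ U)
    (hn1 : 79 / 100 ≤ n) (hn2 : n ≤ 81 / 100) :
    ∀ (ω : InfVolFermionState 2) (Ls : ℕ → ℕ) (ψ : ∀ L, Fock (Orb (FermionTorus 2 L))),
      Tendsto Ls atTop atTop →
      (∀ j, IsGroundStateInSector (hubbardTorusTT' (Ls j) 1 t' U) (rectN n (Ls j)) 0 (ψ (Ls j))) →
      (∀ j, star (ψ (Ls j)) ⬝ᵥ ψ (Ls j) = 1) → ω.IsTorusLimitOf ψ Ls →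
      (ω.expect ({0} : Finset (Site 2))
        (nAt 0 (Finset.mem_singleton_self 0) 0 * nAt 0 (Finset.mem_singleton_self 0) 1)).re < (n / 2) ^ 2 := by
  have hn0 : (0 : ℝ) ≤ n := by linarith
  have hn2' : n < 2 := by linarith
  have hU0 : (0 : ℝ) ≤ U := by linarith
  have hsq : (-6241 / 40000 : ℝ) + 79 / 200 * n ≤ (n / 2) ^ 2 := by nlinarith [sq_nonneg (n - 79 / 100)]
  have hsqU : ((-6241 / 40000 : ℝ) + 79 / 200 * n) * (24 / 5) ≤ (n / 2) ^ 2 * (24 / 5) :=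
    mul_le_mul_of_nonneg_right hsq (by norm_num)
  -- CAP: chord in the density between the two polarised-sea planes (convexity of the density function)
  have ca := ybco106_polCap_n0790 hU0 ht1 ht2
  have cb := ybco106_polCap_n0810 hU0 ht1 ht2
  have hcap := objE_capChord_mul (k := 50) hU0 (by norm_num) (by norm_num) (by norm_num) ca cb hn1 hn2 (by norm_num)
  -- FLOOR: chord in t' between two kernel Fermi-sea columns (concavity in t'), three pieces
  rcases le_or_gt t' (-113 / 200) with hp | hp
  · -- piece `[-13/20, -113/200]`
    have ra := fermiSeaRow4_tPrime_neg_thirteen_div_twenty_at_four_div_five (U := 0) le_rfl hn0 hn2'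
    have rb := fermiSeaRow4_tPrime_neg_hundredthirteen_div_twohundred_at_four_div_five (U := 0) le_rfl hn0 hn2'
    have hfl := objE_floorChord_mul (s := t') (k := 200 / 17) hn0 hn2' (by norm_num : (-13 / 20 : ℝ) < -113 / 200) ra rb ht1 hp (by norm_num)
    exact doccN_lt_of_capUc_threshold (U₁ := 24 / 5) (Uc := U) (by norm_num) hU hU hn0 hn2' hcap hfl
      (by nlinarith only [mul_nonneg (sub_nonneg.2 hn1) (sub_nonneg.2 ht1), mul_nonneg (sub_nonneg.2 hn1) (sub_nonneg.2 hp), mul_nonneg (sub_nonneg.2 hn2) (sub_nonneg.2 ht1), mul_nonneg (sub_nonneg.2 hn2) (sub_nonneg.2 hp), hsqU])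
  · rcases le_or_gt t' (-1 / 2) with hq | hq
    · -- piece `(-113/200, -1/2]`
      have ra := fermiSeaRow4_tPrime_neg_hundredthirteen_div_twohundred_at_four_div_five (U := 0) le_rfl hn0 hn2'
      have rb := fermiSeaTangentRow_tPrime_neg_one_div_two_at_three_div_four (U := 0) le_rfl hn0 hn2'
      have hfl := objE_floorChord_mul (s := t') (k := 200 / 13) hn0 hn2' (by norm_num : (-113 / 200 : ℝ) < -1 / 2) ra rb hp.le hq (by norm_num)
      exact doccN_lt_of_capUc_threshold (U₁ := 24 / 5) (Uc := U) (by norm_num) hU hU hn0 hn2' hcap hfl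
        (by nlinarith only [mul_nonneg (sub_nonneg.2 hn1) (sub_nonneg.2 hp.le), mul_nonneg (sub_nonneg.2 hn1) (sub_nonneg.2 hq), mul_nonneg (sub_nonneg.2 hn2) (sub_nonneg.2 hp.le), mul_nonneg (sub_nonneg.2 hn2) (sub_nonneg.2 hq), hsqU])
    · -- piece `(-1/2, -21/50]` (columns `-1/2`, `-2/5`)
      have ra := fermiSeaTangentRow_tPrime_neg_one_div_two_at_three_div_four (U := 0) le_rfl hn0 hn2'
      have rb := fermiSeaTangentRow_tPrime_neg_two_div_five_at_three_div_four (U := 0) le_rfl hn0 hn2'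
      have hfl := objE_floorChord_mul (s := t') (k := 10) hn0 hn2' (by norm_num : (-1 / 2 : ℝ) < -2 / 5) ra rb hq.le (by linarith) (by norm_num)
      exact doccN_lt_of_capUc_threshold (U₁ := 24 / 5) (Uc := U) (by norm_num) hU hU hn0 hn2' hcap hfl
        (by nlinarith only [mul_nonneg (sub_nonneg.2 hn1) (sub_nonneg.2 hq.le), mul_nonneg (sub_nonneg.2 hn1) (sub_nonneg.2 ht2), mul_nonneg (sub_nonneg.2 hn2) (sub_nonneg.2 hq.le), mul_nonneg (sub_nonneg.2 hn2) (sub_nonneg.2 ht2), hsqU])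

/-! ### §3 The words on the box faces -/

/-- **YBa₂Cu₃O₆.₉₂ (VSET M18), BOX OF RECORD #106, OBJECT E — MF/BCS class excluded on the WHOLE `(t', n)` face of both pressure columns,
`t' ∈ [−13/20, −21/50]` × `n ∈ [81/100, 23/25]`, at EVERY `U ≥ 6`, HYPOTHESIS-FREE** (no claim node: kernel polarised-sea caps + kernel Fermi-sea floors
only). P = 0 box `U/t_eff ∈ [4.7, 11.4]`: covered `[6, 11.4]`; P = 2 GPa `[4.4, 12.0]`: covered `[6, 12.0]`; below `6` see `ybco106E_lowBand_docc_lt`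
(`n ≤ 7/8`, `U ≥ 5.5`) and `ybco106E_lowN_docc_lt`; the rest «undetermined-MF». Every GS torus limit has `Re ω(n_{0↑}n_{0↓}) < (n/2)²`. [cite: KomaTasaki1994, §1] [cite: BachLiebSolovej1994, eq. (2c.36)] [cite: LiebLoss1993, §8, Theorem 8.2] -/
theorem ybco106E_docc_lt {t' U n : ℝ} (ht1 : -13 / 20 ≤ t') (ht2 : t' ≤ -21 / 50) (hU : 6 ≤ U)
    (hn1 : 81 / 100 ≤ n) (hn2 : n ≤ 23 / 25) :
    ∀ (ω : InfVolFermionState 2) (Ls : ℕ → ℕ) (ψ : ∀ L, Fock (Orb (FermionTorus 2 L))),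
      Tendsto Ls atTop atTop →
      (∀ j, IsGroundStateInSector (hubbardTorusTT' (Ls j) 1 t' U) (rectN n (Ls j)) 0 (ψ (Ls j))) →
      (∀ j, star (ψ (Ls j)) ⬝ᵥ ψ (Ls j) = 1) → ω.IsTorusLimitOf ψ Ls →
      (ω.expect ({0} : Finset (Site 2))
        (nAt 0 (Finset.mem_singleton_self 0) 0 * nAt 0 (Finset.mem_singleton_self 0) 1)).re < (n / 2) ^ 2 := by
  rcases le_or_gt n (7 / 8) with hb | hb
  · exact ybco106E_lowBand_docc_lt ht1 ht2 (by linarith) hn1 hb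
  · exact ybco106E_highBand_docc_lt ht1 ht2 hU hb.le hn2

/-- **#106 OBJECT E, the P = 0 letter `t'/t_eff ∈ [−0.63, −0.44]` × `n ∈ [0.81, 0.92]` — MF/BCS class excluded at EVERY `U ≥ 6`, HYPOTHESIS-FREE**
(`U/t_eff` box `[4.7, 11.4]`; a restriction of `ybco106E_docc_lt`). [cite: KomaTasaki1994, §1] [cite: BachLiebSolovej1994, eq. (2c.36)] [cite: LiebLoss1993, §8, Theorem 8.2] -/
theorem ybco106E_P0_docc_lt {t' U n : ℝ} (ht1 : -63 / 100 ≤ t') (ht2 : t' ≤ -11 / 25) (hU : 6 ≤ U)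
    (hn1 : 81 / 100 ≤ n) (hn2 : n ≤ 23 / 25) :
    ∀ (ω : InfVolFermionState 2) (Ls : ℕ → ℕ) (ψ : ∀ L, Fock (Orb (FermionTorus 2 L))),
      Tendsto Ls atTop atTop →
      (∀ j, IsGroundStateInSector (hubbardTorusTT' (Ls j) 1 t' U) (rectN n (Ls j)) 0 (ψ (Ls j))) →
      (∀ j, star (ψ (Ls j)) ⬝ᵥ ψ (Ls j) = 1) → ω.IsTorusLimitOf ψ Ls →
      (ω.expect ({0} : Finset (Site 2))
        (nAt 0 (Finset.mem_singleton_self 0) 0 * nAt 0 (Finset.mem_singleton_self 0) 1)).re < (n / 2) ^ 2 :=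
  ybco106E_docc_lt (by linarith) (by linarith) hU hn1 hn2

/-- **#106 OBJECT E, the wide filling band `n ∈ [79/100, 7/8]` (both `n(plane)` readings below `7/8`), WHOLE `t'`-face — MF/BCS class excluded at
EVERY `U ≥ 11/2`, HYPOTHESIS-FREE** (annex `[0.79, 0.81]` at `4.8` ∪ band `[0.81, 7/8]` at `5.5`). [cite: KomaTasaki1994, §1] [cite: BachLiebSolovej1994, eq. (2c.36)] [cite: LiebLoss1993, §8, Theorem 8.2] -/
theorem ybco106E_wideLowBand_docc_lt {t' U n : ℝ} (ht1 : -13 / 20 ≤ t') (ht2 : t' ≤ -21 / 50) (hU : 11 / 2 ≤ U)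
    (hn1 : 79 / 100 ≤ n) (hn2 : n ≤ 7 / 8) :
    ∀ (ω : InfVolFermionState 2) (Ls : ℕ → ℕ) (ψ : ∀ L, Fock (Orb (FermionTorus 2 L))),
      Tendsto Ls atTop atTop →
      (∀ j, IsGroundStateInSector (hubbardTorusTT' (Ls j) 1 t' U) (rectN n (Ls j)) 0 (ψ (Ls j))) →
      (∀ j, star (ψ (Ls j)) ⬝ᵥ ψ (Ls j) = 1) → ω.IsTorusLimitOf ψ Ls →
      (ω.expect ({0} : Finset (Site 2))
        (nAt 0 (Finset.mem_singleton_self 0) 0 * nAt 0 (Finset.mem_singleton_self 0) 1)).re < (n / 2) ^ 2 := by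
  rcases le_or_gt n (81 / 100) with hb | hb
  · exact ybco106E_lowN_docc_lt ht1 ht2 (by linarith) hn1 hb
  · exact ybco106E_lowBand_docc_lt ht1 ht2 hU hb.le hn2

end Summit.Ventures.CertifiedManyBodySolver.Observables

end
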